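/-
Copyright (c) 2026 the pub-hodgecm-mathlib formalisation cell (harness21).  Prover seat hodgecm-mathlib-A-p19 (g19), topic T5 = P8
«(C♯)hol interior», node Cc (3′) brick β-I «explicit phase of Folland's section at the one-place element» (desk F0P2-plan (g8)
«=» 21:36:48Z; architecture 21:51:53Z).  KERNEL: theorems only.
-/
import Literature.NumberTheory.GelbartRogawski1991.DoubledWeilRepresentationArchPlaceVacuum
import Literature.NumberTheory.Weil1964.ArchFollandCompact
import HarnessLib

/-!
# The phase map of Folland's section at a sign-block compact element is the realified PLACE-BLOCK unitary
# `placeBlock (v ↦ (ā_v ⊕ b_v)^{ε_v})`; at the one-place element `k_{v₀,u}` it is `placeBlock (δ_{v₀} ↦ (W̄_u ⊕ 1)^{e₂})`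
# ([Folland1989, Prop. (4.39)]; [Weil1964, Chap. III n° 37]; [KonnoKonno2007, §3.1])

Topic `NumberTheory/GelbartRogawski1991` (T5 = P8 «(C♯)hol interior», node Cc (3′), brick β-I); namespaces `Literature.NumberTheory.Weil1964`
(§1–§2, generic) and `Literature.NumberTheory.GelbartRogawski1991.GRConstruction` (§3).  KERNEL ONLY: proved theorems; 0 definitions, 0 records,
0 `sorry`.

★ `exists_proj_archWeilSectionS_eq_realifySp` says: if every sign-frame component of `g ∈ U(J)(E ⊗ ℝ)` is sign-block compact
(`archUFormPi g v = kV (a_v, b_v)`), then `proj (archWeilSectionS g) = realifySp u` for SOME unitary `u` of `ℂ^{Fin N × places}` — enough to read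
the VACUUM (★ `MpS.apply_hermitePi_zero_of_proj_eq_realifySp`, bricks (ii)(iii), (J-plc-G)).  Node Cc's step (3′) reads Folland's section on EVERY
Hermite function, so it needs the unitary itself:

* §1 **`reindexUnitary_archIdx_dualPairι_sigmaUnitary`** — the unitary of ★ §3 of `ArchUnitaryWeilHalfCompact`,
  `reindexUnitary archIdx (dualPairι ((diag a, diag b), 1))`, IS the place-block unitary `placeBlock (v ↦ (ā_v ⊕ b_v)^{signSplit x_v})`
  (★ `coe_dualPairι`: the POSITIVE sign block acts through the entrywise CONJUGATE `ā_v`, the negative one through `b_v`); hence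
  **`proj_archWeilSectionS_eq_realifySp_placeBlock`**: `proj (archWeilSectionS g) = realifySp (placeBlock (v ↦ (ā_v ⊕ b_v)^{ε_v}))`;
* §2 **`MpS.apply_eq_vac_smul_unitaryOpPi`** — an element of `Mp^𝓢` over a realified unitary `u` acts by `vac • μ₀(u)` (Schur against
  ★ `MpS.unitary u`, ★ `exists_unitSmul_of_proj_eq`);
* §3 the (C♯) doubled datum at a real place `v₀` where the pair form is POSITIVE: for `u ∈ U(σ_{w(v₀)} diag dV)(ℂ)` there is `W ∈ U(n)` with
  ENTRIES `W i i′ = conj (D_i · (e-reindex (u ⊗ 1_W))_{i i′} · D_{i′}⁻¹)` (`D = √|x_{v₀}|`, the scale of `frameV`) such that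
  **`proj (sectionD k_{v₀,u}) = realifySp (placeBlock (Pi.mulSingle v₀ ((W ⊕ 1)^{e₂⁻¹})))`** and
  **`(sectionD k_{v₀,u}) f = vac (sectionD k_{v₀,u}) • μ₀(placeBlock (Pi.mulSingle v₀ ((W ⊕ 1)^{e₂⁻¹}))) f`**
  (`exists_proj_sectionD_archKPlace_eq_placeBlock_of_pos`, `exists_sectionD_archKPlace_apply_of_pos`) — the input of brick β-II (the same operator
  read through `frameD`/`frameV` on box vectors of Hermite functions) and, with ★ T2 `omega_chiSplitting_placePair_tmul_of_box`, of node Cc's closer.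

HONEST SCOPE.  Statements about the tree's own Weil-representation terms; nothing of [Liu2021] is asserted; HC_CM is NOT proved here or anywhere
in the tree.

References: [Folland1989] G. B. Folland, *Harmonic Analysis in Phase Space* (1989), §4.2 Prop. (4.39); [Weil1964] A. Weil, Acta Math. 111 (1964),
Chap. I n° 12, Chap. III n° 37; [KonnoKonno2007] K. Konno, T. Konno, Kyushu J. Math. 61 (2007), §3.1 (3.1); [BorelJacquet1979] §4.1.
-/

set_option autoImplicit false

noncomputable section

open scoped Matrix Kronecker

/-! ## §1 The unitary of a sign-block compact element is a place-block unitary (generic indices) -/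

namespace Literature.NumberTheory.Weil1964

open Literature.Analysis.SegalBargmann Literature.RepresentationTheory.HeisenbergGroup
open Literature.RepresentationTheory.KonnoKonno2007 Literature.RepresentationTheory.KonnoKonno2007.RealDualPair

section GenericIdx

variable {ι o : Type} [Fintype ι] [DecidableEq ι] [Fintype o] [DecidableEq o] {P Q : o → Type} [∀ v, Fintype (P v)]
  [∀ v, DecidableEq (P v)] [∀ v, Fintype (Q v)] [∀ v, DecidableEq (Q v)]

/-- **the entries of the block unitary of `((diag a, diag b), 1)` at the relabelled indices `Jn (sigmaSumDistrib ⟨v, ε_v k⟩)`** (`Jn` any relabelling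
with `Jn (inl xa) = inl (inl (xa, ⋆))`, `Jn (inr xb) = inr (inr (xb, ⋆))` — the tree's `unitJunctionIdx`, by `rfl`)
are those of the place-block matrix `blockDiagonal (v ↦ (ā_v ⊕ b_v)^{ε_v})` (★ `coe_dualPairι`: the first sign block acts through the entrywise
CONJUGATE `ā_v`, the second through `b_v`; generic indices, matrix level, the junction relabelling a VARIABLE, so that no instance term on the block index type is
re-synthesised). [cite: Folland1989, §4.2 Prop. (4.39)] [cite: Weil1964, Chap. III n° 37] -/
theorem coe_dualPairι_sigmaUnitary_apply_junction (ε : ∀ v, ι ≃ P v ⊕ Q v)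
    (a : ∀ v, Matrix.unitaryGroup (P v) ℂ) (b : ∀ v, Matrix.unitaryGroup (Q v) ℂ)
    (Jn : (Σ v, P v) ⊕ (Σ v, Q v) ≃ DPIdx (Σ v, P v) (Σ v, Q v) Unit Empty)
    (hJl : ∀ xa : Σ v, P v, Jn (Sum.inl xa) = Sum.inl (Sum.inl (xa, PUnit.unit)))
    (hJr : ∀ xb : Σ v, Q v, Jn (Sum.inr xb) = Sum.inr (Sum.inr (xb, PUnit.unit))) (x y : ι × o) :
    (dualPairι (((sigmaUnitary a, sigmaUnitary b), (1 : Matrix.unitaryGroup Unit ℂ × Matrix.unitaryGroup Empty ℂ)) :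
        DPK (Σ v, P v) (Σ v, Q v) Unit Empty)).1
        (Jn (Equiv.sigmaSumDistrib _ _ ⟨x.2, ε x.2 x.1⟩)) (Jn (Equiv.sigmaSumDistrib _ _ ⟨y.2, ε y.2 y.1⟩)) =
      Matrix.blockDiagonal (fun v => ((reindexUnitary (ε v) (blockU (conjU (a v), b v)) : Matrix.unitaryGroup ι ℂ) : Matrix ι ι ℂ)) x y := by
  obtain ⟨k, v⟩ := x
  obtain ⟨k', v'⟩ := y
  rw [Matrix.blockDiagonal_apply]
  have hc : (dualPairι (((sigmaUnitary a, sigmaUnitary b), (1 : Matrix.unitaryGroup Unit ℂ × Matrix.unitaryGroup Empty ℂ)) :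
      DPK (Σ v, P v) (Σ v, Q v) Unit Empty)).1 = _ := coe_dualPairι _
  rw [hc]
  by_cases hv : v = v'
  · subst hv
    rw [if_pos rfl, reindexUnitary_apply, coe_blockU]
    rcases hk : ε v k with p | q <;> rcases hk' : ε v k' with p' | q'
    · show (Matrix.fromBlocks _ _ _ _) (Jn (Sum.inl (Sigma.mk v p))) (Jn (Sum.inl (Sigma.mk v p'))) = _
      rw [hJl, hJl, Matrix.fromBlocks_apply₁₁, Matrix.fromBlocks_apply₁₁, Matrix.map_apply, Matrix.kroneckerMap_apply, coe_sigmaUnitary,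
        Matrix.blockDiagonal'_apply_eq, Matrix.fromBlocks_apply₁₁, coe_conjU, Matrix.map_apply]
      simp
    · show (Matrix.fromBlocks _ _ _ _) (Jn (Sum.inl (Sigma.mk v p))) (Jn (Sum.inr (Sigma.mk v q'))) = _
      rw [hJl, hJr, Matrix.fromBlocks_apply₁₂, Matrix.fromBlocks_apply₁₂, Matrix.zero_apply, Matrix.zero_apply]
    · show (Matrix.fromBlocks _ _ _ _) (Jn (Sum.inr (Sigma.mk v q))) (Jn (Sum.inl (Sigma.mk v p'))) = _
      rw [hJr, hJl, Matrix.fromBlocks_apply₂₁, Matrix.fromBlocks_apply₂₁, Matrix.zero_apply, Matrix.zero_apply]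
    · show (Matrix.fromBlocks _ _ _ _) (Jn (Sum.inr (Sigma.mk v q))) (Jn (Sum.inr (Sigma.mk v q'))) = _
      rw [hJr, hJr, Matrix.fromBlocks_apply₂₂, Matrix.fromBlocks_apply₂₂, Matrix.kroneckerMap_apply, coe_sigmaUnitary,
        Matrix.blockDiagonal'_apply_eq, Matrix.fromBlocks_apply₂₂]
      simp
  · rw [if_neg hv]
    rcases hk : ε v k with p | q <;> rcases hk' : ε v' k' with p' | q'
    · show (Matrix.fromBlocks _ _ _ _) (Jn (Sum.inl (Sigma.mk v p))) (Jn (Sum.inl (Sigma.mk v' p'))) = _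
      rw [hJl, hJl, Matrix.fromBlocks_apply₁₁, Matrix.fromBlocks_apply₁₁, Matrix.map_apply, Matrix.kroneckerMap_apply, coe_sigmaUnitary,
        Matrix.blockDiagonal'_apply_ne _ _ _ hv, zero_mul, star_zero]
    · show (Matrix.fromBlocks _ _ _ _) (Jn (Sum.inl (Sigma.mk v p))) (Jn (Sum.inr (Sigma.mk v' q'))) = _
      rw [hJl, hJr, Matrix.fromBlocks_apply₁₂, Matrix.zero_apply]
    · show (Matrix.fromBlocks _ _ _ _) (Jn (Sum.inr (Sigma.mk v q))) (Jn (Sum.inl (Sigma.mk v' p'))) = _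
      rw [hJr, hJl, Matrix.fromBlocks_apply₂₁, Matrix.zero_apply]
    · show (Matrix.fromBlocks _ _ _ _) (Jn (Sum.inr (Sigma.mk v q))) (Jn (Sum.inr (Sigma.mk v' q'))) = _
      rw [hJr, hJr, Matrix.fromBlocks_apply₂₂, Matrix.fromBlocks_apply₂₂, Matrix.kroneckerMap_apply, coe_sigmaUnitary,
        Matrix.blockDiagonal'_apply_ne _ _ _ hv, zero_mul]

end GenericIdx

section Generic

open scoped Classical
open Literature.NumberTheory.Automorphic Literature.NumberTheory.Automorphic.UnitaryGroup
open NumberField NumberField.InfinitePlace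

variable {F : Type} [Field F] [NumberField F] (E : Type) [Field E] [NumberField E] [Algebra F E] (c : E ≃ₐ[F] E)
  (N : ℕ) (hc : c ≠ 1)
  (wOf : {v : InfinitePlace F // v.IsReal} → {w : InfinitePlace E // w.IsComplex})
  (hw : ∀ v, c • (wOf v).1 = (wOf v).1) (hover : ∀ v, (wOf v).1.comap (algebraMap F E) = v.1)
  (t₀ : Fin N → F) (ht0 : ∀ j, t₀ j ≠ 0) {T : Matrix (Fin N) (Fin N) F} (hTd : T = Matrix.diagonal t₀)
  {J : Matrix (Fin N) (Fin N) E} (hJ : J = T.map (algebraMap F E)) {δ : E} (hcδ : c δ = -δ) (hδ : δ ≠ 0)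

set_option maxHeartbeats 1000000 in
-- (the closing `exact`: unification of the generic §1 entries lemma with the tree's relabelled block unitary unfolds the junction relabelling)
/-- **EXPLICIT unitary phase map at sign-block compact elements**: if `archUFormPi g v = kV (a_v, b_v)` for all `v`, then
`proj (archWeilSectionS g) = realifySp (placeBlock (v ↦ (ā_v ⊕ b_v)^{ε_v}))`, `ε_v = signSplit x_v` — ★ `exists_proj_archWeilSectionS_eq_realifySp` made
explicit: its unitary `reindexUnitary archIdx (dualPairι ((diag a, diag b), 1))` IS the place-block unitary (§1, read on the tree's own terms after the
`simp only` of ★ §3 of `ArchUnitaryWeilHalfCompact`). [cite: Folland1989, §4.2 Prop. (4.39)] [cite: Weil1964, Chap. III n° 37] -/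
theorem proj_archWeilSectionS_eq_realifySp_placeBlock (g : UnitaryGroup.arch F E c N J)
    (a : ∀ v, Matrix.unitaryGroup (PosIdx (signVec wOf t₀ δ v)) ℂ) (b : ∀ v, Matrix.unitaryGroup (NegIdx (signVec wOf t₀ δ v)) ℂ)
    (hg : ∀ v, archUFormPi E c N hc wOf hw hover t₀ ht0 hTd hJ hcδ hδ g v = UForm.kV _ _ (a v, b v)) :
    MpS.proj (archWeilSectionS E c N hc wOf hw hover t₀ ht0 hTd hJ hcδ hδ g) =
      realifySp _ (placeBlock fun v => reindexUnitary (signSplit (signVec wOf t₀ δ v)) (blockU (conjU (a v), b v))) := by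
  have hfun : archUFormPi E c N hc wOf hw hover t₀ ht0 hTd hJ hcδ hδ g = fun v => UForm.kV _ _ (a v, b v) := funext hg
  have h1 : MpS.proj (archWeilSectionS E c N hc wOf hw hover t₀ ht0 hTd hJ hcδ hδ g) =
      reindexSp (archIdx E N wOf t₀ (δ := δ)) (MpS.proj (UnitaryWeil.weilHomV _ _ Unit Empty
        (UForm.placeDiag (archUFormPi E c N hc wOf hw hover t₀ ht0 hTd hJ hcδ hδ g)))) := rfl
  rw [h1, hfun, placeDiag_kV]
  simp only [UnitaryWeil.proj_weilHomV, ι𝕎_kV_one, reindexSp_realifySp]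
  refine congrArg _ (Subtype.ext (Matrix.ext fun x y => ?_))
  -- `archIdx z = unitJunctionIdx (sigmaSumDistrib ⟨z.2, ε_{z.2} z.1⟩)` definitionally
  have hidx : ∀ z : Fin N × {v : InfinitePlace F // v.IsReal}, archIdx E N wOf t₀ (δ := δ) z =
      unitJunctionIdx _ _ (Equiv.sigmaSumDistrib _ _ ⟨z.2, signSplit (signVec wOf t₀ δ z.2) z.1⟩) := fun z => rfl
  -- (`simp only`, not `rw`: the instance arguments of `reindexUnitary_apply` must be MATCHED from the goal — under `Classical` an eager
  -- elaboration synthesises `Classical.propDecidable` on the still-unknown block index type)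
  simp only [reindexUnitary_apply, hidx, coe_placeBlock]
  -- (`(_)` for every instance argument: they are ASSIGNED by unification from the tree's terms in the goal, never re-synthesised
  -- under `Classical` — the block index types carry non-canonical `DecidableEq` terms)
  exact @coe_dualPairι_sigmaUnitary_apply_junction (Fin N) {v : InfinitePlace F // v.IsReal} (_) (_) (_) (_)
    (fun v => PosIdx (signVec wOf t₀ δ v)) (fun v => NegIdx (signVec wOf t₀ δ v)) (_) (_) (_) (_)
    (fun v => signSplit (signVec wOf t₀ δ v)) a b _ (fun _ => rfl) (fun _ => rfl) x y

end Generic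

/-! ## §2 An element of `Mp^𝓢` over a realified unitary acts by `vac • μ₀(u)` -/

section OverCompact

variable {σ : Type} [Fintype σ] [DecidableEq σ]

open Literature.Analysis.SegalBargmann Literature.RepresentationTheory.HeisenbergGroup

/-- **over `U(σ)` an element of `Mp^𝓢(W)` is `vac • μ₀(u)`**: `proj x = realify u ⇒ x f = vac x • μ₀(u) f` for every `f ∈ 𝓢(ℝ^σ)` (Schur against
the compact implementer ★ `MpS.unitary u`, whose vacuum coefficient is `1`). [cite: Folland1989, §4.2 Prop. (4.39), p. 156 L18–30] -/
theorem MpS.apply_eq_vac_smul_unitaryOpPi {x : MpS σ} {u : Matrix.unitaryGroup σ ℂ} (hx : MpS.proj x = realifySp σ u)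
    (f : SchwartzMap (σ → ℝ) ℂ) : x.1.2 f = MpS.vac x • unitaryOpPi u f := by
  obtain ⟨c, -, hcf⟩ := MpS.exists_unitSmul_of_proj_eq (x := MpS.unitary u) (y := x) (by rw [MpS.proj_unitary, hx])
  have hvac : MpS.vac x = c * MpS.vac (MpS.unitary u) := MpS.vac_eq_mul_of_smul hcf
  rw [MpS.vac_unitary, mul_one] at hvac
  rw [hcf, hvac]
  rfl

end OverCompact

end Literature.NumberTheory.Weil1964

/-! ## §3 The (C♯) doubled datum: the phase of Folland's section at `k_{v₀,u}`, pair form POSITIVE at `v₀` -/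

namespace Literature.NumberTheory.GelbartRogawski1991.GRConstruction

open scoped Classical TensorProduct SchwartzMap
open NumberField NumberField.InfinitePlace NumberField.mixedEmbedding IsDedekindDomain
open Literature.RepresentationTheory.HeisenbergGroup
open Literature.NumberTheory.Automorphic Literature.NumberTheory.Automorphic.UnitaryGroup
open Literature.NumberTheory.Weil1964
open Literature.Analysis.SegalBargmann
open Literature.RepresentationTheory.KonnoKonno2007 Literature.RepresentationTheory.KonnoKonno2007.RealDualPair
open UnitaryDualPair UnitaryDualPair.ArchSplitting
open Literature.NumberTheory.GelbartRogawski1991.UnitaryDualPair.LocalSplitting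

variable (L : Type) [Field L] [NumberField L] [IsCMField L]

variable {N M n : ℕ} (e : Fin N × Fin M ≃ Fin n)
  (dV : Fin N → L) (hdV : ∀ i, IsCMField.complexConj L (dV i) = dV i) (hdV0 : ∀ i, dV i ≠ 0)
  (dW : Fin M → L) (hdW : ∀ i, IsCMField.complexConj L (dW i) = dW i) (hdW0 : ∀ i, dW i ≠ 0)
  (v₀ : {v : InfinitePlace (Fp L) // v.IsReal})

set_option maxHeartbeats 1600000 in
-- (entry bookkeeping through `archUFormPi`/`kV`/`signSplit`/`e₂` at every real place; one `simp` per sign case)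
/-- **THE PHASE OF FOLLAND'S SECTION AT `k_{v₀,u}`, pair form POSITIVE at `v₀`**: there is `W ∈ U(n)` with entries
`W i i′ = conj (D_i · (e-reindex (u ⊗ 1_W))_{i i′} · D_{i′}⁻¹)` (`D = √|x_{v₀}|`, the scale of `frameV` at `v₀`) such that
`proj (sectionD k_{v₀,u}) = realifySp (placeBlock (Pi.mulSingle v₀ ((W ⊕ 1)^{e₂⁻¹})))` — at `v₀` the first copy moves by the CONJUGATE of the
scaled-frame matrix of `u ⊗ 1_W` (★ `coe_dualPairι`: the positive sign block is conjugated) and the second copy is fixed; every other real place is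
fixed (★ `coe_archAt_archKPlace`, ★ `archAt_archSingle_of_ne`). [cite: Folland1989, §4.2 Prop. (4.39)] [cite: KonnoKonno2007, §3.1 (3.1), Lemma 5.2 p. 73]
[cite: BorelJacquet1979, §4.1] -/
theorem exists_proj_sectionD_archKPlace_eq_placeBlock_of_pos (u : UnitaryGroup.archLocal L N (Matrix.diagonal dV) (cmPlaceOver L v₀))
    (hpos : ∀ k : Fin n, 0 < signVec (cmPlaceOver L) (cmGramEntry L e dV hdV dW hdW) (imagUnit L) v₀ k) :
    ∃ W : Matrix.unitaryGroup (Fin n) ℂ,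
      (∀ i i' : Fin n, (W : Matrix (Fin n) (Fin n) ℂ) i i' =
        star ((((sqrtAbs (signVec (cmPlaceOver L) (cmGramEntry L e dV hdV dW hdW) (imagUnit L) v₀) i : ℝ) : ℂ)) *
          Matrix.reindex e e
            ((((u : UnitaryGroup.archLocal L N (Matrix.diagonal dV) (cmPlaceOver L v₀)) : GL (Fin N) ℂ) : Matrix (Fin N) (Fin N) ℂ) ⊗ₖ
              (1 : Matrix (Fin M) (Fin M) ℂ)) i i' *
          (((sqrtAbs (signVec (cmPlaceOver L) (cmGramEntry L e dV hdV dW hdW) (imagUnit L) v₀) i' : ℝ) : ℂ))⁻¹)) ∧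
      MpS.proj (sectionD L e dV hdV hdV0 dW hdW hdW0 (archKPlace L e dV hdV dW hdW v₀ u)) =
        realifySp _ (placeBlock (Pi.mulSingle v₀ (reindexUnitary (e₂ (n := n)).symm (blockU (W, 1))))) := by
  have hdef : ∀ k k' : Fin n, (0 < signVec (cmPlaceOver L) (cmGramEntry L e dV hdV dW hdW) (imagUnit L) v₀ k ↔
      0 < signVec (cmPlaceOver L) (cmGramEntry L e dV hdV dW hdW) (imagUnit L) v₀ k') := fun k k' => ⟨fun _ => hpos k', fun _ => hpos k⟩
  choose k hk using exists_archUFormPi_archKPlace_eq_kV L e dV hdV hdV0 dW hdW hdW0 v₀ u hdef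
  -- the positive indices at `v₀` are exactly the first copy: `φ : Fin n ≃ PosIdx`
  have hmem : ∀ a : Fin n, 0 < signVec (cmPlaceOver L) (entryD L e dV hdV dW hdW) (imagUnit L) v₀ ((e₂ (n := n)) (Sum.inl a)) := fun a => by
    rw [signVec_doubled_inl]; exact hpos a
  have hnot : ∀ a : Fin n, ¬ 0 < signVec (cmPlaceOver L) (entryD L e dV hdV dW hdW) (imagUnit L) v₀ ((e₂ (n := n)) (Sum.inr a)) := fun a => by
    rw [signVec_doubled_inr, neg_pos, not_lt]; exact (hpos a).le
  have hsurj : ∀ p : PosIdx (signVec (cmPlaceOver L) (entryD L e dV hdV dW hdW) (imagUnit L) v₀), ∃ a : Fin n, p.1 = (e₂ (n := n)) (Sum.inl a) := by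
    rintro ⟨x, hx⟩
    obtain ⟨s, rfl⟩ := (e₂ (n := n)).surjective x
    rcases s with a | a
    · exact ⟨a, rfl⟩
    · exact absurd hx (hnot a)
  obtain ⟨φ, hφ⟩ : ∃ φ : Fin n ≃ PosIdx (signVec (cmPlaceOver L) (entryD L e dV hdV dW hdW) (imagUnit L) v₀),
      ∀ a, (φ a).1 = (e₂ (n := n)) (Sum.inl a) :=
    ⟨Equiv.ofBijective (fun a => (⟨(e₂ (n := n)) (Sum.inl a), hmem a⟩ : PosIdx (signVec (cmPlaceOver L) (entryD L e dV hdV dW hdW) (imagUnit L) v₀)))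
      ⟨fun a a' h => Sum.inl_injective ((e₂ (n := n)).injective (congrArg Subtype.val h)),
        fun p => by obtain ⟨a, ha⟩ := hsurj p; exact ⟨a, Subtype.ext ha.symm⟩⟩, fun a => rfl⟩
  -- the sign-frame component at `v` in coordinates: `(fromBlocks k₁ 0 0 k₂) (ε x) (ε y) = D_x · (k_{v₀,u})_{w(v)} x y · D_y⁻¹`
  have hent : ∀ (v : {v : InfinitePlace (Fp L) // v.IsReal}) (x y : Fin (n + n)),
      Matrix.fromBlocks ((k v).1 : Matrix _ _ ℂ) 0 0 ((k v).2 : Matrix _ _ ℂ)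
          (signSplit (signVec (cmPlaceOver L) (entryD L e dV hdV dW hdW) (imagUnit L) v) x)
          (signSplit (signVec (cmPlaceOver L) (entryD L e dV hdV dW hdW) (imagUnit L) v) y) =
        (((sqrtAbs (signVec (cmPlaceOver L) (entryD L e dV hdV dW hdW) (imagUnit L) v) x : ℝ) : ℂ)) *
          (((UnitaryGroup.archAt (Fp L) L (IsCMField.complexConj L) (n + n) (hermD L e dV hdV dW hdW) (cmPlaceOver L v) (cmPlaceOver_smul L v)
              (IsCMField.complexConj_ne_one L) (archKPlace L e dV hdV dW hdW v₀ u) :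
              UnitaryGroup.archLocal L (n + n) (hermD L e dV hdV dW hdW) (cmPlaceOver L v)) : GL (Fin (n + n)) ℂ) : Matrix (Fin (n + n)) (Fin (n + n)) ℂ) x y *
          ((((sqrtAbs (signVec (cmPlaceOver L) (entryD L e dV hdV dW hdW) (imagUnit L) v) y : ℝ) : ℂ))⁻¹) := fun v x y => by
    have h := congrArg (fun g : UForm (PosIdx (signVec (cmPlaceOver L) (entryD L e dV hdV dW hdW) (imagUnit L) v))
        (NegIdx (signVec (cmPlaceOver L) (entryD L e dV hdV dW hdW) (imagUnit L) v)) =>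
          ((g : GL (PosIdx (signVec (cmPlaceOver L) (entryD L e dV hdV dW hdW) (imagUnit L) v) ⊕
              NegIdx (signVec (cmPlaceOver L) (entryD L e dV hdV dW hdW) (imagUnit L) v)) ℂ) :
            Matrix (PosIdx (signVec (cmPlaceOver L) (entryD L e dV hdV dW hdW) (imagUnit L) v) ⊕
                NegIdx (signVec (cmPlaceOver L) (entryD L e dV hdV dW hdW) (imagUnit L) v))
              (PosIdx (signVec (cmPlaceOver L) (entryD L e dV hdV dW hdW) (imagUnit L) v) ⊕
                NegIdx (signVec (cmPlaceOver L) (entryD L e dV hdV dW hdW) (imagUnit L) v)) ℂ)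
          (signSplit (signVec (cmPlaceOver L) (entryD L e dV hdV dW hdW) (imagUnit L) v) x)
          (signSplit (signVec (cmPlaceOver L) (entryD L e dV hdV dW hdW) (imagUnit L) v) y)) (hk v)
    simp only [UForm.coe_kV, archUFormPi_apply, coe_archUForm, archPart_archToAdelic, Matrix.reindex_apply, Matrix.submatrix_apply,
      Equiv.symm_apply_apply, scaleConj_apply] at h
    exact h.symm
  -- `D ≠ 0`
  have hD0 : ∀ (v : {v : InfinitePlace (Fp L) // v.IsReal}) (x : Fin (n + n)),
      (((sqrtAbs (signVec (cmPlaceOver L) (entryD L e dV hdV dW hdW) (imagUnit L) v) x : ℝ) : ℂ)) ≠ 0 := fun v x =>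
    Complex.ofReal_ne_zero.mpr (sqrtAbs_signVec_ne_zero (IsCMField.complexConj_ne_one L) (cmPlaceOver_smul L)
      (complexConj_imagUnit L) (imagUnit_ne_zero L) (gramD_gram_realDiagonal_entry_ne_zero L e dV hdV dW hdW hdV0 hdW0) v x)
  -- `ε (e₂ (inl i)) = inl (φ i)`, `ε (e₂ (inr j)) = inr ⟨_, _⟩` at `v₀`
  have hεl : ∀ i : Fin n, signSplit (signVec (cmPlaceOver L) (entryD L e dV hdV dW hdW) (imagUnit L) v₀) ((e₂ (n := n)) (Sum.inl i)) = Sum.inl (φ i) :=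
    fun i => by
    rw [show φ i = ⟨(e₂ (n := n)) (Sum.inl i), hmem i⟩ from Subtype.ext (hφ i)]
    exact Equiv.sumCompl_symm_apply_of_pos (p := fun j => 0 < signVec (cmPlaceOver L) (entryD L e dV hdV dW hdW) (imagUnit L) v₀ j)
      (a := (e₂ (n := n)) (Sum.inl i)) (hmem i)
  have hεr : ∀ j : Fin n, signSplit (signVec (cmPlaceOver L) (entryD L e dV hdV dW hdW) (imagUnit L) v₀) ((e₂ (n := n)) (Sum.inr j)) =
      Sum.inr ⟨(e₂ (n := n)) (Sum.inr j), hnot j⟩ := fun j =>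
    Equiv.sumCompl_symm_apply_of_neg (p := fun j => 0 < signVec (cmPlaceOver L) (entryD L e dV hdV dW hdW) (imagUnit L) v₀ j)
      (a := (e₂ (n := n)) (Sum.inr j)) (hnot j)
  refine ⟨reindexUnitary φ (conjU (k v₀).1), fun i i' => ?_, ?_⟩
  · -- the entries of `W`
    have h := hent v₀ ((e₂ (n := n)) (Sum.inl i)) ((e₂ (n := n)) (Sum.inl i'))
    rw [hεl, hεl, Matrix.fromBlocks_apply₁₁, coe_archAt_archKPlace, Matrix.reindex_apply, Matrix.submatrix_apply, Equiv.symm_apply_apply,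
      Equiv.symm_apply_apply, Matrix.fromBlocks_apply₁₁] at h
    erw [UnitaryGroup.archAt_archSingle_self (Fp L) L (IsCMField.complexConj L) N (Matrix.diagonal dV) (IsCMField.complexConj_ne_one L)
      (complexConj_smul_infinitePlace L) (cmPlaceOver L v₀) u] at h
    rw [reindexUnitary_apply, coe_conjU, Matrix.map_apply, h]
    simp only [sqrtAbs, signVec_doubled_inl]
  · -- the phase map
    rw [show MpS.proj (sectionD L e dV hdV hdV0 dW hdW hdW0 (archKPlace L e dV hdV dW hdW v₀ u)) = _ from
      proj_archWeilSectionS_eq_realifySp_placeBlock L (IsCMField.complexConj L) (n + n) (IsCMField.complexConj_ne_one L) (cmPlaceOver L)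
        (cmPlaceOver_smul L) (cmPlaceOver_comap L) (entryD L e dV hdV dW hdW)
        (gramD_gram_realDiagonal_entry_ne_zero L e dV hdV dW hdW hdV0 hdW0) (gramD_eq_diagonal_cm L e dV hdV dW hdW)
        (J := hermD L e dV hdV dW hdW) rfl (complexConj_imagUnit L) (imagUnit_ne_zero L) (archKPlace L e dV hdV dW hdW v₀ u)
        (fun v => (k v).1) (fun v => (k v).2) (fun v => by rw [Prod.mk.eta]; exact hk v)]
    refine congrArg _ (congrArg placeBlock (funext fun v => ?_))
    by_cases hv : v = v₀
    · subst hv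
      rw [Pi.mulSingle_eq_same]
      apply Subtype.ext
      refine Matrix.ext fun x y => ?_
      obtain ⟨s, rfl⟩ := (e₂ (n := n)).surjective x
      obtain ⟨t, rfl⟩ := (e₂ (n := n)).surjective y
      rw [reindexUnitary_apply, reindexUnitary_apply, coe_blockU, coe_blockU, coe_conjU, Equiv.symm_apply_apply, Equiv.symm_apply_apply]
      rcases s with i | j <;> rcases t with i' | j'
      · rw [hεl, hεl, Matrix.fromBlocks_apply₁₁, Matrix.fromBlocks_apply₁₁, Matrix.map_apply, reindexUnitary_apply, coe_conjU, Matrix.map_apply]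
      · rw [hεl, hεr, Matrix.fromBlocks_apply₁₂, Matrix.fromBlocks_apply₁₂, Matrix.zero_apply, Matrix.zero_apply]
      · rw [hεr, hεl, Matrix.fromBlocks_apply₂₁, Matrix.fromBlocks_apply₂₁, Matrix.zero_apply, Matrix.zero_apply]
      · rw [hεr, hεr, Matrix.fromBlocks_apply₂₂, Matrix.fromBlocks_apply₂₂]
        have h := hent v ((e₂ (n := n)) (Sum.inr j)) ((e₂ (n := n)) (Sum.inr j'))
        rw [hεr, hεr, Matrix.fromBlocks_apply₂₂, coe_archAt_archKPlace, Matrix.reindex_apply, Matrix.submatrix_apply, Equiv.symm_apply_apply,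
          Equiv.symm_apply_apply, Matrix.fromBlocks_apply₂₂] at h
        rw [h]
        show _ = ((1 : Matrix.unitaryGroup (Fin n) ℂ) : Matrix (Fin n) (Fin n) ℂ) j j'
        rw [OneMemClass.coe_one]
        by_cases hj : j = j'
        · subst hj
          rw [Matrix.one_apply_eq, mul_one, mul_inv_cancel₀ (hD0 v _)]
        · rw [Matrix.one_apply_ne hj, mul_zero, zero_mul]
    · rw [Pi.mulSingle_eq_of_ne hv]
      -- at `v ≠ v₀` the component is `1`: `(k_{v₀,u})_{w(v)} = 1`
      have hne : cmPlaceOver L v ≠ cmPlaceOver L v₀ := fun h => hv (Subtype.ext (by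
        rw [← cmPlaceOver_comap L v, ← cmPlaceOver_comap L v₀, h]))
      have hG : (((UnitaryGroup.archAt (Fp L) L (IsCMField.complexConj L) (n + n) (hermD L e dV hdV dW hdW) (cmPlaceOver L v) (cmPlaceOver_smul L v)
          (IsCMField.complexConj_ne_one L) (archKPlace L e dV hdV dW hdW v₀ u) :
          UnitaryGroup.archLocal L (n + n) (hermD L e dV hdV dW hdW) (cmPlaceOver L v)) : GL (Fin (n + n)) ℂ) : Matrix (Fin (n + n)) (Fin (n + n)) ℂ) = 1 := by
        rw [coe_archAt_archKPlace]
        erw [UnitaryGroup.archAt_archSingle_of_ne (Fp L) L (IsCMField.complexConj L) N (Matrix.diagonal dV) (IsCMField.complexConj_ne_one L)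
          (complexConj_smul_infinitePlace L) (cmPlaceOver L v₀) hne u]
        simp only [OneMemClass.coe_one, Units.val_one, Matrix.one_kronecker_one, Matrix.reindex_apply, Matrix.submatrix_one_equiv,
          Matrix.fromBlocks_one]
      apply Subtype.ext
      refine Matrix.ext fun x y => ?_
      rw [reindexUnitary_apply, coe_blockU, coe_conjU, OneMemClass.coe_one]
      have h := hent v x y
      rw [hG] at h
      rcases hx : signSplit (signVec (cmPlaceOver L) (entryD L e dV hdV dW hdW) (imagUnit L) v) x with p | q <;>
        rcases hy : signSplit (signVec (cmPlaceOver L) (entryD L e dV hdV dW hdW) (imagUnit L) v) y with p' | q'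
      · rw [hx, hy, Matrix.fromBlocks_apply₁₁] at h
        rw [Matrix.fromBlocks_apply₁₁, Matrix.map_apply, h]
        by_cases hxy : x = y
        · subst hxy; rw [Matrix.one_apply_eq, mul_one, mul_inv_cancel₀ (hD0 v _), star_one]
        · rw [Matrix.one_apply_ne hxy, mul_zero, zero_mul, star_zero]
      · have hx' : x = p.1 := ((Equiv.symm_apply_eq _).mp hx).trans (Equiv.sumCompl_apply_inl p)
        have hy' : y = q'.1 := ((Equiv.symm_apply_eq _).mp hy).trans (Equiv.sumCompl_apply_inr q')
        have hxy : x ≠ y := fun hxy => q'.2 (hy' ▸ hxy ▸ hx' ▸ p.2)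
        rw [Matrix.fromBlocks_apply₁₂, Matrix.zero_apply, Matrix.one_apply_ne hxy]
      · have hx' : x = q.1 := ((Equiv.symm_apply_eq _).mp hx).trans (Equiv.sumCompl_apply_inr q)
        have hy' : y = p'.1 := ((Equiv.symm_apply_eq _).mp hy).trans (Equiv.sumCompl_apply_inl p')
        have hxy : x ≠ y := fun hxy => q.2 (hx' ▸ hxy ▸ hy' ▸ p'.2)
        rw [Matrix.fromBlocks_apply₂₁, Matrix.zero_apply, Matrix.one_apply_ne hxy]
      · rw [hx, hy, Matrix.fromBlocks_apply₂₂] at h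
        rw [Matrix.fromBlocks_apply₂₂, h]
        by_cases hxy : x = y
        · subst hxy; rw [Matrix.one_apply_eq, mul_one, mul_inv_cancel₀ (hD0 v _)]
        · rw [Matrix.one_apply_ne hxy, mul_zero, zero_mul]

/-- **THE OPERATOR OF FOLLAND'S SECTION AT `k_{v₀,u}`, pair form POSITIVE at `v₀`**: with `W` as in
`exists_proj_sectionD_archKPlace_eq_placeBlock_of_pos`, `sectionD k_{v₀,u}` acts on `𝓢(ℝ^{Fin (n+n) × places})` by
`vac (sectionD k_{v₀,u}) • μ₀(placeBlock (Pi.mulSingle v₀ ((W ⊕ 1)^{e₂⁻¹})))` (§2; `vac = 1` here by ★ `vac_sectionD_archKPlace_of_pos`, kept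
symbolic) — the hypothesis `hS` of ★ T2 `omega_chiSplitting_placePair_tmul_of_box` up to the frame transport of brick β-II.
[cite: Folland1989, §4.2 Prop. (4.39)] [cite: KonnoKonno2007, Lemma 5.2 p. 73] -/
theorem exists_sectionD_archKPlace_apply_of_pos (u : UnitaryGroup.archLocal L N (Matrix.diagonal dV) (cmPlaceOver L v₀))
    (hpos : ∀ k : Fin n, 0 < signVec (cmPlaceOver L) (cmGramEntry L e dV hdV dW hdW) (imagUnit L) v₀ k) :
    ∃ W : Matrix.unitaryGroup (Fin n) ℂ,
      (∀ i i' : Fin n, (W : Matrix (Fin n) (Fin n) ℂ) i i' =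
        star ((((sqrtAbs (signVec (cmPlaceOver L) (cmGramEntry L e dV hdV dW hdW) (imagUnit L) v₀) i : ℝ) : ℂ)) *
          Matrix.reindex e e
            ((((u : UnitaryGroup.archLocal L N (Matrix.diagonal dV) (cmPlaceOver L v₀)) : GL (Fin N) ℂ) : Matrix (Fin N) (Fin N) ℂ) ⊗ₖ
              (1 : Matrix (Fin M) (Fin M) ℂ)) i i' *
          (((sqrtAbs (signVec (cmPlaceOver L) (cmGramEntry L e dV hdV dW hdW) (imagUnit L) v₀) i' : ℝ) : ℂ))⁻¹)) ∧
      ∀ f : SchwartzMap ((Fin (n + n) × {v : InfinitePlace (Fp L) // v.IsReal}) → ℝ) ℂ,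
        (sectionD L e dV hdV hdV0 dW hdW hdW0 (archKPlace L e dV hdV dW hdW v₀ u)).1.2 f =
          MpS.vac (sectionD L e dV hdV hdV0 dW hdW hdW0 (archKPlace L e dV hdV dW hdW v₀ u)) •
            unitaryOpPi (placeBlock (Pi.mulSingle v₀ (reindexUnitary (e₂ (n := n)).symm (blockU (W, 1))))) f := by
  obtain ⟨W, hW, hproj⟩ := exists_proj_sectionD_archKPlace_eq_placeBlock_of_pos L e dV hdV hdV0 dW hdW hdW0 v₀ u hpos
  exact ⟨W, hW, fun f => MpS.apply_eq_vac_smul_unitaryOpPi hproj f⟩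

end Literature.NumberTheory.GelbartRogawski1991.GRConstruction

end
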